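import Summits.QuantumFields.YangMills.Theorems.FluctuationComparisonRegPrIntLOrganTangentAPackageDescendTo
import Summits.QuantumFields.YangMills.Theorems.FluctuationComparisonRegPrIntLOrganTangentFibreMeanVersionKnitAnyCut
import HarnessLib

/-!
# `FluctuationComparisonRegPrIntLOrganTangentFibreMeanVersionKnitDescendTo` — (L17) KNIT-MW: the m-STEP FIBRE-MEAN VERSION along `descendTo F ℰp j K` with a
# multi-level-window weight (✓KNITc `…FibreMeanVersionKnitAnyCut._ac` with `descend ↦ descendTo j K`, `cW`-window ↦ `MW_{j,K}`), and — from a height — KNIT-MW ∘ ✓(L16)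

Cell `ym3-torus` (rung R3 = continuum `SU(2)` Yang–Mills on T³ — NOT d = 4, NOT infinite volume, NOT a mass gap, NOT Clay), width seat `ym-ust-20520-w5` (gen 22),
pen (L17) (offered 2026-08-31 00:06Z to LEAD-20520 w3 g24, first refusal).  `--kind proof --supports stmt-QuantumFields-20520 --as helper`, count-neutral, definition-free,
default heartbeats; THEOREMS ONLY; nothing printed is asserted.

WHAT.  The v18 m-step organ rows transport the localised fibre mean `E′[(∏_{n} χ_n ∘ descendTo_n) · h | descendTo j K = V]` (V18-TYPING-SPEC §3; LEAD WORD №2: the weight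
is the product of the tower's own cut-offs, supported in the multi-level window `MW_{j,K}`).  Its CONTINUOUS VERSION on the coarse window is this file's §1 for ANY continuous
weight `χ ≥ 0` supported in and positive on `MW_{j,K}`, given the (A)-package of `descendTo` on `MW` — which ✓(L16) `…APackageDescendTo.exists_height_regularSmallFieldDisintegration_descendTo`
supplies from a height; §2 is the composition «VERSION along `descendTo` FROM A HEIGHT, for every family, every depth, every disintegration, every admissible weight and density triple».
§1 ★★ `fibreMeanVersion_descendTo_of_regularSmallFieldDisintegration_ac` (KNIT-MW; proof = ✓KNITc's byte for byte up to the renamings; transfer lemma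
✓`OrganTangentFibreMeanVersionKnit.ae_on_of_ae_map_of_ac_of_map_eq` and the TOOLS are generic in the averaging map).
§2 ★★★ `exists_height_fibreMeanVersion_descendTo` — from a height `jA`: for every `j ≥ jA`, `K ≥ j+1`, densities `r r′` (positive, continuous on the top window), `rj`
(measurable, positive on `window_j`) and `mY ≪ dU_K` with `mY.map (descendTo j K) = rj·dU_j`, every MW-weight `χ`, every disintegration `σ`: the version `m` exists.
NOT HERE: the m-step row texts (v18), their lift∕(M3) letters, anything of Bałaban's estimates.
[cite: Balaban1985Averaging, (10)-(13) p.19; Balaban1987RG1, (0.11) p.253 and (0.13) p.254; Balaban1985UV3, (7) p.257]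

HONEST: measure-theoretic plumbing (a renaming of a landed knit + one composition); nothing of Bałaban's RG estimates is asserted or proved; O1 ∕ O1ᵘ-H ∕ m-step rows ∕ LIN∘ ∕
JVAR∘ ∕ MODE∘ ∕ crux 20520 `FluctuationComparisonRegPrIntL` ∕ `YM3TorusSU2` NOT proved; registry `Lines/semiclassical_s2beta.lean` v11.4 (★★OWNER RULING №36) untouched; rung R3 =
SU(2) YM₃ on T³ — NOT d = 4, NOT infinite volume, NOT a mass gap, NOT Clay; the Yang–Mills mass gap is NOT proved by any of this.
-/

set_option autoImplicit false

noncomputable section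

namespace Summit.QuantumFields.YangMills.Theorems.FluctuationComparisonRegPrIntLOrganTangentFibreMeanVersionKnitDescendTo

open MeasureTheory ProbabilityTheory Filter Topology Set
open scoped ENNReal
open Literature.MathematicalPhysics.QuantumFieldTheory.Balaban1983to89
open T3ContinuumYM3Torus T3NestedUnitLaws T3UnitLawDensityEML T3UnitScaleTilt T3TiltDescent
open Literature.MathematicalPhysics.QuantumFieldTheory.Balaban1983to89.T3OrbitAverage
open Summit.QuantumFields.YangMills.Theorems.OrganTangentFibreMeanTools
open Summit.QuantumFields.YangMills.BalabanUVNodes.N09DomAltThresholdNull (isOpen_setOf_plaqSmall_SU)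
open Summit.QuantumFields.YangMills.Theorems.FluctuationComparisonRegPrIntLOrganTangentAPackageDescendTo (exists_height_regularSmallFieldDisintegration_descendTo)

/-! ## §1 KNIT-MW -/

/-- ★★ **KNIT-MW — THE m-STEP FIBRE-MEAN VERSION ALONG `descendTo F ℰp j K` WITH A MULTI-LEVEL-WINDOW WEIGHT** (see the module docstring): ✓KNITc's
`fibreMeanVersion_of_regularSmallFieldDisintegration_ac` with `descend ↦ descendTo j K`, fine level `j+1 ↦ K` (`r, r′` positive and continuous on the TOP window
`{PlaqSmall θ_K}`, `0 < θ_K`), `cW`-window ↦ `MW_{j,K}` (the weight `χ ≥ 0` is continuous, supported in and positive on `MW_{j,K}`), consistency `mY ≪ dU_K`,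
`mY.map (descendTo j K) = rj·dU_j` (`rj` measurable, positive on `window_j`), and the (A)-package binders of ✓`…APackageDescendTo` (§2∕§3) VERBATIM.  Conclusion: for
EVERY disintegration `σ` of `dU_K` along `descendTo j K`, a `window_j`-continuous `m` with `χ·(log r − log r′)·r′` `σ_V`-integrable and
`m V = (∫ χ (log r − log r′) r′ dσ_V) ∕ (∫ χ r′ dσ_V)` for `dU_j`-a.e. `V ∈ window_j`.
[cite: Balaban1985Averaging, (10)-(13) p.19; Balaban1987RG1, (0.11) p.253 and (0.13) p.254; Balaban1985UV3, (7) p.257] -/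
theorem fibreMeanVersion_descendTo_of_regularSmallFieldDisintegration_ac
    (F : T3Family) (γ b₀ p₀ : ℝ) (j K : ℕ) (hjK : j + 1 ≤ K) (hθ : 0 < θBal F.L γ b₀ p₀ K)
    (r r' : GaugeField (F.P K) 0 ↥(Matrix.specialUnitaryGroup (Fin 2) ℂ) → ℝ)
    (rj : GaugeField (F.P j) 0 ↥(Matrix.specialUnitaryGroup (Fin 2) ℂ) → ℝ)
    (hpos : ∀ U, PlaqSmall (θBal F.L γ b₀ p₀ K) U → 0 < r U ∧ 0 < r' U)
    (hr : ContinuousOn r {U | PlaqSmall (θBal F.L γ b₀ p₀ K) U})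
    (hr' : ContinuousOn r' {U | PlaqSmall (θBal F.L γ b₀ p₀ K) U})
    (hrj : Measurable rj) (hrjpos : ∀ V, PlaqSmall (θBal F.L γ b₀ p₀ j) V → 0 < rj V)
    (mY : Measure (GaugeField (F.P K) 0 ↥(Matrix.specialUnitaryGroup (Fin 2) ℂ)))
    (hmY : mY ≪ fieldMeasure (F.P K) 0 ↥(Matrix.specialUnitaryGroup (Fin 2) ℂ))
    (hcons : mY.map (descendTo F ℰp j K (Nat.le_of_succ_le hjK)) =
      (fieldMeasure (F.P j) 0 ↥(Matrix.specialUnitaryGroup (Fin 2) ℂ)).withDensity (fun V => ENNReal.ofReal (rj V)))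
    (σ : Kernel (GaugeField (F.P j) 0 ↥(Matrix.specialUnitaryGroup (Fin 2) ℂ))
      (GaugeField (F.P K) 0 ↥(Matrix.specialUnitaryGroup (Fin 2) ℂ)))
    (hσM : IsMarkovKernel σ)
    (hbind : (Measure.map (descendTo F ℰp j K (Nat.le_of_succ_le hjK)) (fieldMeasure (F.P K) 0 ↥(Matrix.specialUnitaryGroup (Fin 2) ℂ))).bind ⇑σ =
      fieldMeasure (F.P K) 0 ↥(Matrix.specialUnitaryGroup (Fin 2) ℂ))
    (hfib : ∀ᵐ V ∂(Measure.map (descendTo F ℰp j K (Nat.le_of_succ_le hjK)) (fieldMeasure (F.P K) 0 ↥(Matrix.specialUnitaryGroup (Fin 2) ℂ))),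
      ∀ᵐ U ∂(σ V), descendTo F ℰp j K (Nat.le_of_succ_le hjK) U = V)
    (χ : GaugeField (F.P K) 0 ↥(Matrix.specialUnitaryGroup (Fin 2) ℂ) → ℝ) (hχc : Continuous χ) (hχ0 : ∀ U, 0 ≤ χ U)
    (hχsupp : ∀ U, χ U ≠ 0 → (∀ (n : ℕ) (hjn : j + 1 ≤ n) (hnK : n ≤ K), PlaqSmall (24 / 25 * θBal F.L γ b₀ p₀ n) (descendTo F ℰp n K hnK U)))
    (hχpos : ∀ U, (∀ (n : ℕ) (hjn : j + 1 ≤ n) (hnK : n ≤ K), PlaqSmall (24 / 25 * θBal F.L γ b₀ p₀ n) (descendTo F ℰp n K hnK U)) → 0 < χ U)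
    (σ₀ : Kernel (GaugeField (F.P j) 0 ↥(Matrix.specialUnitaryGroup (Fin 2) ℂ))
      (GaugeField (F.P K) 0 ↥(Matrix.specialUnitaryGroup (Fin 2) ℂ)))
    (hσ₀M : IsMarkovKernel σ₀)
    (hbind₀ : (Measure.map (descendTo F ℰp j K (Nat.le_of_succ_le hjK)) (fieldMeasure (F.P K) 0 ↥(Matrix.specialUnitaryGroup (Fin 2) ℂ))).bind ⇑σ₀ =
      fieldMeasure (F.P K) 0 ↥(Matrix.specialUnitaryGroup (Fin 2) ℂ))
    (hfib₀ : ∀ᵐ V ∂(Measure.map (descendTo F ℰp j K (Nat.le_of_succ_le hjK)) (fieldMeasure (F.P K) 0 ↥(Matrix.specialUnitaryGroup (Fin 2) ℂ))),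
      ∀ᵐ U ∂(σ₀ V), descendTo F ℰp j K (Nat.le_of_succ_le hjK) U = V)
    (lam : GaugeField (F.P j) 0 ↥(Matrix.specialUnitaryGroup (Fin 2) ℂ) →
      Measure (GaugeField (F.P K) 0 ↥(Matrix.specialUnitaryGroup (Fin 2) ℂ)))
    (hlam : ∀ V, IsFiniteMeasure (lam V))
    (hA1 : ∀ f : GaugeField (F.P K) 0 ↥(Matrix.specialUnitaryGroup (Fin 2) ℂ) → ℝ, Continuous f →
      (∀ U, f U ≠ 0 → (∀ (n : ℕ) (hjn : j + 1 ≤ n) (hnK : n ≤ K), PlaqSmall (24 / 25 * θBal F.L γ b₀ p₀ n) (descendTo F ℰp n K hnK U))) →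
      ContinuousOn (fun V => ∫ U, f U ∂(lam V)) {V | PlaqSmall (θBal F.L γ b₀ p₀ j) V})
    (hA2 : ∀ V, PlaqSmall (θBal F.L γ b₀ p₀ j) V → 0 < lam V {U | (∀ (n : ℕ) (hjn : j + 1 ≤ n) (hnK : n ≤ K), PlaqSmall (24 / 25 * θBal F.L γ b₀ p₀ n) (descendTo F ℰp n K hnK U))})
    (hA3 : ∃ c : GaugeField (F.P j) 0 ↥(Matrix.specialUnitaryGroup (Fin 2) ℂ) → ℝ,
      ∀ f : GaugeField (F.P K) 0 ↥(Matrix.specialUnitaryGroup (Fin 2) ℂ) → ℝ, Continuous f →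
        (∀ U, ¬ (∀ (n : ℕ) (hjn : j + 1 ≤ n) (hnK : n ≤ K), PlaqSmall (24 / 25 * θBal F.L γ b₀ p₀ n) (descendTo F ℰp n K hnK U)) → f U = 0) →
        ∀ᵐ V ∂(Measure.map (descendTo F ℰp j K (Nat.le_of_succ_le hjK)) (fieldMeasure (F.P K) 0 ↥(Matrix.specialUnitaryGroup (Fin 2) ℂ))),
          PlaqSmall (θBal F.L γ b₀ p₀ j) V → 0 < c V ∧ ∫ U, f U ∂(σ₀ V) = c V * ∫ U, f U ∂(lam V)) :
    ∃ m : GaugeField (F.P j) 0 ↥(Matrix.specialUnitaryGroup (Fin 2) ℂ) → ℝ,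
      ContinuousOn m {V | PlaqSmall (θBal F.L γ b₀ p₀ j) V} ∧
      (∀ᵐ V ∂(fieldMeasure (F.P j) 0 ↥(Matrix.specialUnitaryGroup (Fin 2) ℂ)), PlaqSmall (θBal F.L γ b₀ p₀ j) V →
        Integrable (fun U => χ U * (Real.log (r U) - Real.log (r' U)) * r' U) (σ V) ∧
        m V = (∫ U, χ U * (Real.log (r U) - Real.log (r' U)) * r' U ∂(σ V)) / (∫ U, χ U * r' U ∂(σ V))) := by
  haveI := hσM
  haveI := hσ₀M
  haveI : BorelSpace (GaugeField (F.P K) 0 ↥(Matrix.specialUnitaryGroup (Fin 2) ℂ)) :=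
    T3OrbitAverage.instBorelSpaceGaugeField
  -- abbreviations
  set θ' : ℝ := θBal F.L γ b₀ p₀ K with hθ'
  set θj : ℝ := θBal F.L γ b₀ p₀ j with hθj
  set Hf : Measure (GaugeField (F.P K) 0 ↥(Matrix.specialUnitaryGroup (Fin 2) ℂ)) :=
    fieldMeasure (F.P K) 0 ↥(Matrix.specialUnitaryGroup (Fin 2) ℂ) with hHf
  set Hc : Measure (GaugeField (F.P j) 0 ↥(Matrix.specialUnitaryGroup (Fin 2) ℂ)) :=
    fieldMeasure (F.P j) 0 ↥(Matrix.specialUnitaryGroup (Fin 2) ℂ) with hHc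
  haveI : IsProbabilityMeasure Hf := Missing.isProbabilityMeasure_fieldMeasure _ _
  haveI : Nonempty (GaugeField (F.P K) 0 ↥(Matrix.specialUnitaryGroup (Fin 2) ℂ)) := ⟨fun _ => 1⟩
  have hd : Measurable (descendTo F ℰp j K (Nat.le_of_succ_le hjK) :
      GaugeField (F.P K) 0 ↥(Matrix.specialUnitaryGroup (Fin 2) ℂ) →
        GaugeField (F.P j) 0 ↥(Matrix.specialUnitaryGroup (Fin 2) ℂ)) :=
    measurable_descendTo F ℰp measurableE_ℰp _
  -- the multi-level window sits inside the `24∕25·θ_K`-window (its level-`K` clause), hence inside the open top window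
  have hMWtop : ∀ U : GaugeField (F.P K) 0 ↥(Matrix.specialUnitaryGroup (Fin 2) ℂ), (∀ (n : ℕ) (hjn : j + 1 ≤ n) (hnK : n ≤ K), PlaqSmall (24 / 25 * θBal F.L γ b₀ p₀ n) (descendTo F ℰp n K hnK U)) →
      PlaqSmall (24 / 25 * θBal F.L γ b₀ p₀ K) U := by
    intro U hU
    have h := hU K hjK le_rfl
    rw [T3DescentFibreTower.descendTo_self] at h
    exact h
  have hcut : 24 / 25 * θBal F.L γ b₀ p₀ K < θBal F.L γ b₀ p₀ K := by nlinarith [hθ]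
  -- the windows
  set O : Set (GaugeField (F.P K) 0 ↥(Matrix.specialUnitaryGroup (Fin 2) ℂ)) := {U | PlaqSmall θ' U} with hO
  set O₃ : Set (GaugeField (F.P K) 0 ↥(Matrix.specialUnitaryGroup (Fin 2) ℂ)) := {U | (∀ (n : ℕ) (hjn : j + 1 ≤ n) (hnK : n ≤ K), PlaqSmall (24 / 25 * θBal F.L γ b₀ p₀ n) (descendTo F ℰp n K hnK U))} with hO₃
  set W : Set (GaugeField (F.P j) 0 ↥(Matrix.specialUnitaryGroup (Fin 2) ℂ)) := {V | PlaqSmall θj V} with hW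
  have hOopen : IsOpen O := isOpen_setOf_plaqSmall_SU 2 (F.P K) 0 θ'
  have hχts : tsupport χ ⊆ O := tsupport_subset_plaqSmall hcut fun U hU => hMWtop U (hχsupp U hU)
  have hO₃O : O₃ ⊆ O := fun U hU p => (hMWtop U hU p).trans hcut
  -- the two localised integrands, globally continuous
  set g : GaugeField (F.P K) 0 ↥(Matrix.specialUnitaryGroup (Fin 2) ℂ) → ℝ :=
    fun U => (Real.log (r U) - Real.log (r' U)) * r' U with hg
  have hgc : ContinuousOn g O :=
    ((hr.log fun U hU => (hpos U hU).1.ne').sub (hr'.log fun U hU => (hpos U hU).2.ne')).mul hr'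
  set f₁ : GaugeField (F.P K) 0 ↥(Matrix.specialUnitaryGroup (Fin 2) ℂ) → ℝ := fun U => χ U * g U with hf₁
  set f₂ : GaugeField (F.P K) 0 ↥(Matrix.specialUnitaryGroup (Fin 2) ℂ) → ℝ := fun U => χ U * r' U with hf₂
  have hf₁c : Continuous f₁ := continuous_mul_of_tsupport_subset hOopen hχc hχts hgc
  have hf₂c : Continuous f₂ := continuous_mul_of_tsupport_subset hOopen hχc hχts hr'
  have hf₁eq : (fun U => χ U * (Real.log (r U) - Real.log (r' U)) * r' U) = f₁ := by
    funext U; simp only [hf₁, hg]; ring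
  have hf₁supp : ∀ U, f₁ U ≠ 0 → (∀ (n : ℕ) (hjn : j + 1 ≤ n) (hnK : n ≤ K), PlaqSmall (24 / 25 * θBal F.L γ b₀ p₀ n) (descendTo F ℰp n K hnK U)) :=
    fun U hU => hχsupp U (left_ne_zero_of_mul hU)
  have hf₂supp : ∀ U, f₂ U ≠ 0 → (∀ (n : ℕ) (hjn : j + 1 ≤ n) (hnK : n ≤ K), PlaqSmall (24 / 25 * θBal F.L γ b₀ p₀ n) (descendTo F ℰp n K hnK U)) :=
    fun U hU => hχsupp U (left_ne_zero_of_mul hU)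
  have hf₁zero : ∀ U, U ∉ O₃ → f₁ U = 0 := fun U hU => by
    by_contra h; exact hU (hf₁supp U h)
  have hf₂zero : ∀ U, U ∉ O₃ → f₂ U = 0 := fun U hU => by
    by_contra h; exact hU (hf₂supp U h)
  have hf₂nn : ∀ U, 0 ≤ f₂ U := by
    intro U
    by_cases hU : χ U = 0
    · simp only [hf₂, hU, zero_mul, le_refl]
    · exact mul_nonneg (hχ0 U) (hpos U (hO₃O (hχsupp U hU))).2.le
  have hf₂O₃ : ∀ U, U ∈ O₃ → f₂ U ≠ 0 := fun U hU =>
    mul_ne_zero (hχpos U hU).ne' (hpos U (hO₃O hU)).2.ne'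
  -- the version
  set num : GaugeField (F.P j) 0 ↥(Matrix.specialUnitaryGroup (Fin 2) ℂ) → ℝ := fun V => ∫ U, f₁ U ∂(lam V) with hnum
  set den : GaugeField (F.P j) 0 ↥(Matrix.specialUnitaryGroup (Fin 2) ℂ) → ℝ := fun V => ∫ U, f₂ U ∂(lam V) with hden
  have hnumc : ContinuousOn num W := hA1 f₁ hf₁c hf₁supp
  have hdenc : ContinuousOn den W := hA1 f₂ hf₂c hf₂supp
  have hdenpos : ∀ V, V ∈ W → 0 < den V := by
    intro V hV
    haveI := hlam V
    have hint : Integrable f₂ (lam V) := integrable_of_continuous_compact hf₂c (lam V)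
    rw [hden]
    refine (integral_pos_iff_support_of_nonneg_ae (Eventually.of_forall hf₂nn) hint).mpr ?_
    exact (hA2 V hV).trans_le (measure_mono fun U hU => Function.mem_support.mpr (hf₂O₃ U hU))
  refine ⟨fun V => num V / den V, hnumc.div hdenc fun V hV => (hdenpos V hV).ne', ?_⟩
  -- uniqueness of the disintegration: σ = σ₀ a.e.
  have huniq : ∀ᵐ V ∂(Hf.map (descendTo F ℰp j K (Nat.le_of_succ_le hjK))), σ V = σ₀ V :=
    ae_eq_of_bind_of_bind Hf hd σ σ₀ hbind hfib hbind₀ hfib₀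
  -- the identity, `descendTo_* dU_K`-a.e. on the window
  have hkey : ∀ᵐ V ∂(Hf.map (descendTo F ℰp j K (Nat.le_of_succ_le hjK))), V ∈ W →
      (Integrable (fun U => χ U * (Real.log (r U) - Real.log (r' U)) * r' U) (σ V) ∧
        num V / den V = (∫ U, χ U * (Real.log (r U) - Real.log (r' U)) * r' U ∂(σ V)) / (∫ U, χ U * r' U ∂(σ V))) := by
    obtain ⟨c, hc⟩ := hA3
    filter_upwards [huniq, hc f₁ hf₁c hf₁zero, hc f₂ hf₂c hf₂zero] with V hVσ hV1 hV2
    intro hVW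
    refine ⟨?_, ?_⟩
    · rw [hf₁eq]; exact integrable_of_continuous_compact hf₁c (σ V)
    obtain ⟨hc0, hres1⟩ := hV1 hVW
    obtain ⟨-, hres2⟩ := hV2 hVW
    rw [hf₁eq, show (fun U => χ U * r' U) = f₂ from rfl, hVσ, hres1, hres2, mul_div_mul_left _ _ hc0.ne']
  -- transfer `descend_* dU_{j+1}`-a.e. ⇒ `dU_j`-a.e. on the window through the (≪-form) consistency identity
  have hWne : ∀ V ∈ W, ENNReal.ofReal (rj V) ≠ 0 := fun V hV => (ENNReal.ofReal_pos.mpr (hrjpos V hV)).ne'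
  have hρX : AEMeasurable (fun V => ENNReal.ofReal (rj V)) Hc := (ENNReal.measurable_ofReal.comp hrj).aemeasurable
  have := OrganTangentFibreMeanVersionKnit.ae_on_of_ae_map_of_ac_of_map_eq Hf hd Hc mY hmY hρX hcons hWne hkey
  filter_upwards [this] with V hV hVW
  exact hV hVW hVW


/-! ## §2 From a height: the version along `descendTo`, for every family, depth, weight and disintegration -/

/-- ★★★ **THE m-STEP FIBRE-MEAN VERSION ALONG `descendTo` FROM A HEIGHT** — §1 ∘ ✓`exists_height_regularSmallFieldDisintegration_descendTo` ((L16)): for every family `F`,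
`0 < γ ≤ 1`, `0 < b₀`, `0 < p₀` there is `jA` such that for all `j ≥ jA`, `K ≥ j+1`, every density triple `(r, r′, rj)` with `≪`-consistency `mY`, every continuous weight
`χ ≥ 0` supported in and positive on `MW_{j,K}`, and EVERY disintegration `σ` of `dU_K` along `descendTo j K`, a `window_j`-continuous version `m` of the `χ`-localised fibre mean
of `log r − log r′` exists. [cite: Balaban1985Averaging, (10)-(13) p.19; Balaban1987RG1, (0.11) p.253 and (0.13) p.254; Balaban1985UV3, (7) p.257] -/
theorem exists_height_fibreMeanVersion_descendTo
    (F : T3Family) (γ b₀ p₀ : ℝ) (hγ : 0 < γ) (hγ1 : γ ≤ 1) (hb₀ : 0 < b₀) (hp₀ : 0 < p₀) :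
    ∃ jA : ℕ, ∀ (j : ℕ), jA ≤ j → ∀ (K : ℕ) (hjK : j + 1 ≤ K),
      ∀ (r r' : GaugeField (F.P K) 0 ↥(Matrix.specialUnitaryGroup (Fin 2) ℂ) → ℝ) (rj : GaugeField (F.P j) 0 ↥(Matrix.specialUnitaryGroup (Fin 2) ℂ) → ℝ),
        (∀ U, PlaqSmall (θBal F.L γ b₀ p₀ K) U → 0 < r U ∧ 0 < r' U) →
        ContinuousOn r {U | PlaqSmall (θBal F.L γ b₀ p₀ K) U} → ContinuousOn r' {U | PlaqSmall (θBal F.L γ b₀ p₀ K) U} →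
        Measurable rj → (∀ V, PlaqSmall (θBal F.L γ b₀ p₀ j) V → 0 < rj V) →
      ∀ (mY : Measure (GaugeField (F.P K) 0 ↥(Matrix.specialUnitaryGroup (Fin 2) ℂ))), mY ≪ fieldMeasure (F.P K) 0 ↥(Matrix.specialUnitaryGroup (Fin 2) ℂ) →
        mY.map (descendTo F ℰp j K (Nat.le_of_succ_le hjK)) = (fieldMeasure (F.P j) 0 ↥(Matrix.specialUnitaryGroup (Fin 2) ℂ)).withDensity (fun V => ENNReal.ofReal (rj V)) →
      ∀ (χ : GaugeField (F.P K) 0 ↥(Matrix.specialUnitaryGroup (Fin 2) ℂ) → ℝ), Continuous χ → (∀ U, 0 ≤ χ U) →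
        (∀ U, χ U ≠ 0 → (∀ (n : ℕ) (hjn : j + 1 ≤ n) (hnK : n ≤ K), PlaqSmall (24 / 25 * θBal F.L γ b₀ p₀ n) (descendTo F ℰp n K hnK U))) → (∀ U, (∀ (n : ℕ) (hjn : j + 1 ≤ n) (hnK : n ≤ K), PlaqSmall (24 / 25 * θBal F.L γ b₀ p₀ n) (descendTo F ℰp n K hnK U)) → 0 < χ U) →
      ∀ (σ : Kernel (GaugeField (F.P j) 0 ↥(Matrix.specialUnitaryGroup (Fin 2) ℂ)) (GaugeField (F.P K) 0 ↥(Matrix.specialUnitaryGroup (Fin 2) ℂ))), IsMarkovKernel σ →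
        (Measure.map (descendTo F ℰp j K (Nat.le_of_succ_le hjK)) (fieldMeasure (F.P K) 0 ↥(Matrix.specialUnitaryGroup (Fin 2) ℂ))).bind ⇑σ = fieldMeasure (F.P K) 0 ↥(Matrix.specialUnitaryGroup (Fin 2) ℂ) →
        (∀ᵐ V ∂(Measure.map (descendTo F ℰp j K (Nat.le_of_succ_le hjK)) (fieldMeasure (F.P K) 0 ↥(Matrix.specialUnitaryGroup (Fin 2) ℂ))),
          ∀ᵐ U ∂(σ V), descendTo F ℰp j K (Nat.le_of_succ_le hjK) U = V) →
      ∃ m : GaugeField (F.P j) 0 ↥(Matrix.specialUnitaryGroup (Fin 2) ℂ) → ℝ,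
        ContinuousOn m {V | PlaqSmall (θBal F.L γ b₀ p₀ j) V} ∧
        (∀ᵐ V ∂(fieldMeasure (F.P j) 0 ↥(Matrix.specialUnitaryGroup (Fin 2) ℂ)), PlaqSmall (θBal F.L γ b₀ p₀ j) V →
          Integrable (fun U => χ U * (Real.log (r U) - Real.log (r' U)) * r' U) (σ V) ∧
          m V = (∫ U, χ U * (Real.log (r U) - Real.log (r' U)) * r' U ∂(σ V)) / (∫ U, χ U * r' U ∂(σ V))) := by
  obtain ⟨jA, hjA⟩ := exists_height_regularSmallFieldDisintegration_descendTo F γ b₀ p₀ hγ hγ1 hb₀ hp₀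
  refine ⟨jA, fun j hj K hjK r r' rj hpos hr hr' hrj hrjpos mY hmY hcons χ hχc hχ0 hχsupp hχpos σ hσM hbind hfib => ?_⟩
  obtain ⟨σ₀, lam, hσ₀M, hbind₀, hfib₀, hlam, hA1, hA2, hA3⟩ := hjA j hj K hjK
  have hθ : 0 < θBal F.L γ b₀ p₀ K := T3MinimiserStabilityReduction.θBal_pos F.hL.2.le hγ hγ1 hb₀ p₀ K
  exact fibreMeanVersion_descendTo_of_regularSmallFieldDisintegration_ac F γ b₀ p₀ j K hjK hθ r r' rj hpos hr hr' hrj hrjpos mY hmY hcons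
    σ hσM hbind hfib χ hχc hχ0 hχsupp hχpos σ₀ hσ₀M hbind₀ hfib₀ lam hlam hA1 hA2 hA3

end Summit.QuantumFields.YangMills.Theorems.FluctuationComparisonRegPrIntLOrganTangentFibreMeanVersionKnitDescendTo

end
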